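import Literature.NumberTheory.EllipticCurves.Yin2026.CubeSumCMPoints
import Literature.NumberTheory.EllipticCurves.Kriz2020.SylvesterProofs
import Literature.NumberTheory.EllipticCurves.LeadingTermProofs
import Literature.NumberTheory.EllipticCurves.AnalyticRankWindow
import Literature.NumberTheory.EllipticCurves.BSDRootNumberOddParityProofs
import Literature.NumberTheory.EllipticCurves.SelmerCorankHolds
import Literature.NumberTheory.EllipticCurves.ComplexMultiplicationShaHeckeProofs
import HarnessLib

/-!
# Sylvester's problem for primes `p ≡ 4, 7 (mod 9)` and rank-BSD for `x³ + y³ = p`, `x³ + y³ = p²` — modulo Yin's two claimed theorems (the second door)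

HONEST FRAMING (cell `bsd-cn100`, `run/shared/lean/pub/bsd-cn100/`; companion at `p = 3` of the
congruent-number work in `Kriz2020/`). The tree now has TWO independent doors to Sylvester's
statement "every prime `p ≡ 4, 7, 8 (mod 9)` is a sum of two rational cubes" (Sylvester 1879;
Dasgupta–Voight 2018, Conjecture 1), each through exactly named UNREFEREED hypotheses and
otherwise published, named inputs:

| door | file | unrefereed binder(s) | classes of `p` | also `p²`? | other named inputs |
|---|---|---|---|---|---|
| `3`-converse | `Kriz2020/SylvesterProofs.lean` | `hK3 : rankOne_threeConverse_mordellCurve` (Kříž v5 Thm. 10.13/10.14 = Fan–Wan v2 Thm. 1.1; both GAP-LOCALISED, `VERDICT.md` I–IV) | `4, 7, 8` | no | `hGZK`, Satgé `hSel`, root number `hw`, `3`-parity `hpar` |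
| CM points (this file) | `Yin2026/SylvesterFourSevenProofs.lean` | `hY : Yin2026.exists_not_isOfFinAddOrder_cubeSumCurve` (Yin arXiv:2605.25917v3 Thm. 8.7; GAP-LOCALISED, `VERDICT.md` V) and/or `hYGZ : Yin2026.deriv_entireLFunction_one_ne_zero_cubeSumCurve` (Yin arXiv:2607.01744v1 Thm. 1.1 with v3 Thm. 8.6; one half-read, no adjudication) | `4, 7` | yes | none for the cube sums; `hGZK` (+ `hw` or Deuring–Hecke `hH`) for rank-BSD; Satgé `hSel` for the Selmer clause |

Nothing here discharges `hY` or `hYGZ`; a proof of either in print would make the corresponding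
theorems below unconditional in the tree except for the published named facts they list. The
class `p ≡ 8 (mod 9)` is reached ONLY through the first door.

## What is proved (model `E_d : Y² = X³ − 432 d²` of `x³ + y³ = d`, `d = p^i ∈ {p, p²}`)

§0 (glue on `E_d`, unconditional): `E_d` is elliptic; `L(E_d, s)` is entire given the
Deuring–Hecke continuation for `j = 0` (`hasEntireLFunction_cubeSumCurve`, binder `hH`); a point of
infinite order of `E_d(ℚ)` is an affine point, hence gives `x³ + y³ = d`
(`exists_cube_add_cube_of_not_isOfFinAddOrder` — no Mordell–Weil needed), and gives
`rank E_d(ℚ) ≥ 1` (`one_le_mordellWeilRank_of_not_isOfFinAddOrder_cubeSumCurve`, Mordell–Weil);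
`L'(E, 1) ≠ 0` with `L` entire gives `ord_{s=1} L(E, s) ≤ 1`, and with a point of infinite order
and Gross–Zagier–Kolyvagin `ord = rank = 1`, `#Ш < ∞`
(`bsdRank_of_deriv_ne_zero_of_one_le_mordellWeilRank`).

§1 (door `hY` alone — Yin v3 Thm. 1.1 verbatim, and the ranks): for every prime `p ≡ 4, 7 (mod 9)`
and `d ∈ {p, p²}`: `∃ x y : ℚ, x³ + y³ = d` (`exists_cube_add_cube_of_yin`,
`sylvester_four_seven_of_yin`) and `rank E_d(ℚ) ≥ 1` (`one_le_mordellWeilRank_cubeSumCurve_of_yin`).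

§2 (door `hY` + Satgé 1986, parity-free, no `L`-functions): `rank E_p(ℚ) = 1`,
`corank_{ℤ₃} Sel_{3^∞}(E_p/ℚ) = 1`, `corank_{ℤ₃} Ш(E_p/ℚ)[3^∞] = 0`
(`mordellWeilRank_eq_one_cubeSumCurve_prime_of_yin`: `1 ≤ rank ≤ corank Sel ≤ 1` through the
tree's proved identity `corank Sel_{p^∞} = rank + corank Ш[p^∞]`,
`selmerCorank_eq_mordellWeilRank_add_holds`); twin `…_of_le_two` from Fan–Wan's printed reading
`corank ≤ 2` plus the root number and `3`-parity.

§3 (door `hYGZ` + the root number `w(E_p) = −1`): `ord_{s=1} L(E_p, s) = 1`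
(`analyticRank_eq_one_cubeSumCurve_prime_of_yinGZ`: `≤ 1` from `L' ≠ 0`, odd from `w = −1`,
`L` entire from `w = −1` unconditionally in the tree); with Gross–Zagier–Kolyvagin
`rank E_p(ℚ) = ord = 1`, `#Ш(E_p) < ∞` and `x³ + y³ = p`
(`bsdRank_cubeSumCurve_prime_of_yinGZ`, `exists_cube_add_cube_eq_prime_of_yinGZ`) — Sylvester
for `p` itself without v3's Thm. 8.7 (though `hYGZ` leans on v3's Thm. 8.6), but not for `p²`
(the tree has no root-number fact for `E_{p²}`; use §4).

§4 (both binders + Gross–Zagier–Kolyvagin + Deuring–Hecke): for `d ∈ {p, p²}`,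
**`ord_{s=1} L(E_d, s) = rank E_d(ℚ) = 1 ∧ #Ш(E_d/ℚ) < ∞`** (`bsdRank_cubeSumCurve_of_yin`) — the
rank part of the Birch–Swinnerton-Dyer conjecture for these curves, i.e. the companion's
"rank = analytic rank = 1" clause for the classes `4, 7 (mod 9)` INCLUDING `p²`, exactly as the
cell referee reads the two preprints together (`VERDICT.md` Part V §5.3: "combined with v3 Thm 8.7
… it would give `r_an(E_{p^i}) = 1` for `p ≡ 4, 7 (9)`").

Why `hY` is typed as "a point of infinite order" and not as the cube-sum sentence: the latter is
EQUIVALENT to the former for cube-free `d > 2` only through the torsion classification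
`E_d(ℚ)_tors = 0` (Selmer 1951), which the tree does not have; the former is what v3 §8 actually
proves (l. 1529–1541) and is what every consumer needs. Why `hYGZ` is the consequence `L' ≠ 0`
and not the Gross–Zagier identity: module docstring of `Yin2026/CubeSumCMPoints.lean`, item 4.

Technical note (`convert`): the `DecidableEq ℚ` instance inside Mathlib's group law on `E(ℚ)` is
the computable one in statements elaborated at `ℚ` (the hypothesis `hY`) and the classical one in
the generic prelude facts (`module_finite_point`, `mordellWeilRank`); they agree by subsingleton
elimination, as in `GrossZagierRationalPoint.lean`.
-/

noncomputable section

open scoped Classical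

open WeierstrassCurve

namespace Literature.NumberTheory.EllipticCurves.Yin2026

/-! ### §0 Glue on `E_d : Y² = X³ − 432 d²` -/

/-- `d = p` or `d = p²` with `p` prime is non-zero. [folklore] -/
private theorem ne_zero_of_eq_prime_or_eq_sq {p : ℕ} (hp : p.Prime) {d : ℚ}
    (hdp : d = p ∨ d = (p : ℚ) ^ 2) : d ≠ 0 := by
  have hp0 : (p : ℚ) ≠ 0 := by exact_mod_cast hp.ne_zero
  rcases hdp with rfl | rfl
  · exact hp0
  · exact pow_ne_zero 2 hp0

/-- `p ≡ 4, 7 (mod 9)` is a sub-case of `p ≡ 4, 7, 8 (mod 9)` (the range of the published inputs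
`hSel`, `hw` of `CubeSumPrimeDescentInputs.lean`). [folklore] -/
private theorem mod_nine_of_four_seven {p : ℕ} (h9 : p % 9 = 4 ∨ p % 9 = 7) :
    p % 9 = 4 ∨ p % 9 = 7 ∨ p % 9 = 8 :=
  h9.elim Or.inl fun h ↦ Or.inr (Or.inl h)

/-- `E_d : Y² = X³ − 432 d²` is an elliptic curve for `d ≠ 0` (`Δ = −432·(432 d²)² ≠ 0`;
Dasgupta–Voight 2018 §1.1: "the Weierstrass equation `y² = x³ − 432n²`" of the elliptic curve
`E_n`). [cite: DasguptaVoight2018, §1.1] -/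
theorem isElliptic_cubeSumCurve {d : ℚ} (hd : d ≠ 0) : (mordellCurve (-(432 * d ^ 2))).IsElliptic :=
  isElliptic_mordellCurve (neg_ne_zero.mpr (by positivity))

/-- `L(E_d, s)` is entire, from the Deuring–Hecke continuation for CM curves (`hH`; `E_d` has
`c₄ = 0`, `j = 0 ∈ maximalCMJInvariants`, CM by `ℤ[(1+√−3)/2]`). Silverman, *Advanced Topics*,
II Cor. 10.5.1. [cite: SilvermanATAEC1994, Ch. II Cor. 10.5.1] -/
theorem hasEntireLFunction_cubeSumCurve (hH : hasEntireLFunction_of_j_mem_maximalCMJInvariants)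
    {d : ℚ} (hd : d ≠ 0) : (mordellCurve (-(432 * d ^ 2))).HasEntireLFunction := by
  haveI := isElliptic_cubeSumCurve hd
  refine hH _ ?_
  rw [(mordellCurve (-(432 * d ^ 2))).j_eq_zero (mordellCurve_c₄ _)]
  simp [maximalCMJInvariants]

/-- A point of infinite order of `E_d(ℚ)` is an affine point `(X, Y)` (the origin is torsion), and
the model link `x = (36 d + Y)/(6 X)`, `y = (36 d − Y)/(6 X)` turns it into `x³ + y³ = d`
(`exists_cube_add_cube_of_mordellCurve_equation`; Dasgupta–Voight 2018 §1.1). No Mordell–Weil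
theorem is used. [cite: DasguptaVoight2018, §1.1] -/
theorem exists_cube_add_cube_of_not_isOfFinAddOrder {d : ℚ} (hd : d ≠ 0)
    {P : (mordellCurve (-(432 * d ^ 2))).toAffine.Point} (hP : ¬ IsOfFinAddOrder P) :
    ∃ x y : ℚ, x ^ 3 + y ^ 3 = d := by
  rcases P with _ | ⟨X, Y, hXY⟩
  · exact absurd (by rw [← Affine.Point.zero_def]; exact IsOfFinAddOrder.zero) hP
  · exact exists_cube_add_cube_of_mordellCurve_equation hd hXY.1

/-- A point of infinite order of `E_d(ℚ)` gives `rank E_d(ℚ) ≥ 1` (Mordell–Weil,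
`module_finite_point_holds`, and `one_le_mordellWeilRank_of_not_isOfFinAddOrder`; Silverman AEC
VIII.6.7). [cite: SilvermanAEC2009, Thm. VIII.6.7] -/
theorem one_le_mordellWeilRank_of_not_isOfFinAddOrder_cubeSumCurve {d : ℚ} (hd : d ≠ 0)
    {P : (mordellCurve (-(432 * d ^ 2))).toAffine.Point} (hP : ¬ IsOfFinAddOrder P) :
    1 ≤ (mordellCurve (-(432 * d ^ 2))).mordellWeilRank := by
  haveI := isElliptic_cubeSumCurve hd
  -- `convert`: computable vs classical `DecidableEq ℚ` inside the group law (module docstring)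
  exact one_le_mordellWeilRank_of_not_isOfFinAddOrder _
    (mordellCurve (-(432 * d ^ 2))).module_finite_point_holds (P := P) (by convert hP)

/-- **`L'(E, 1) ≠ 0` and a point of infinite order give rank-BSD at rank one.** For an elliptic
curve `E/ℚ` with `L(E, s)` entire: `L'(E, 1) ≠ 0` gives `ord_{s=1} L(E, s) ≤ 1`
(`analyticRank_le_of_iteratedDeriv_ne_zero`); Gross–Zagier–Kolyvagin (`hGZK`) then gives
`rank E(ℚ) = ord` and `#Ш < ∞`; a point of infinite order (`1 ≤ rank`) pins both to `1`.
(Gross–Zagier 1986 Thm. I.7.3; Kolyvagin 1990; Darmon 2004 Thm. 3.22.) [cite: Darmon2004, Thm. 3.22] -/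
theorem bsdRank_of_deriv_ne_zero_of_one_le_mordellWeilRank
    (hGZK : rank_eq_analyticRank_of_analyticRank_le_one) (W : WeierstrassCurve ℚ) [W.IsElliptic]
    (hL : W.HasEntireLFunction) (h1 : deriv W.entireLFunction 1 ≠ 0) (hMW : 1 ≤ W.mordellWeilRank) :
    W.analyticRank = 1 ∧ W.mordellWeilRank = 1 ∧ Finite W.sha := by
  have hle : W.analyticRank ≤ 1 :=
    analyticRank_le_of_iteratedDeriv_ne_zero W hL (n := 1) (by rwa [iteratedDeriv_one])
  obtain ⟨heq, hsha⟩ := hGZK W hle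
  exact ⟨by omega, by omega, hsha⟩

/-! ### §1 Door `hY` alone: Sylvester for `p ≡ 4, 7 (mod 9)`, for `p` and `p²`, and the ranks -/

/-- **`d ∈ {p, p²}` is a sum of two rational cubes for every prime `p ≡ 4, 7 (mod 9)` — modulo
Yin's claimed Thm. 8.7** (`hY`, arXiv:2605.25917v3, UNREFEREED, GAP-LOCALISED by the cell): the
claimed point of infinite order on `Y² = X³ − 432 d²` is affine and maps to a solution. This is
Yin's Thm. 1.1 verbatim ("both `p` and `p²` are sums of two rational cubes"), recovered from the
form in which it is vendored. [cite: Yin2026SylvesterFourSeven, Thm. 1.1 (= Thm. 8.7) of v3]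
[cite: DasguptaVoight2018, Conj. 1] -/
theorem exists_cube_add_cube_of_yin (hY : exists_not_isOfFinAddOrder_cubeSumCurve)
    {p : ℕ} (hp : p.Prime) (h9 : p % 9 = 4 ∨ p % 9 = 7) {d : ℚ} (hdp : d = p ∨ d = (p : ℚ) ^ 2) :
    ∃ x y : ℚ, x ^ 3 + y ^ 3 = d := by
  obtain ⟨P, hP⟩ := hY hp h9 hdp
  exact exists_cube_add_cube_of_not_isOfFinAddOrder (ne_zero_of_eq_prime_or_eq_sq hp hdp) hP

/-- **Sylvester's problem for the primes `p ≡ 4, 7 (mod 9)` modulo ONE unrefereed input, second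
door** (Yin v3 Thm. 1.1, as the conjunction printed): `p` AND `p²` are sums of two rational cubes.
Compare `sylvester_exists_cube_add_cube_eq_prime_of_converse` (first door: classes `4, 7, 8`, `p`
only, four further published inputs). [cite: Yin2026SylvesterFourSeven, Thm. 1.1 of v3]
[cite: DasguptaVoight2018, Conj. 1] -/
theorem sylvester_four_seven_of_yin (hY : exists_not_isOfFinAddOrder_cubeSumCurve)
    {p : ℕ} (hp : p.Prime) (h9 : p % 9 = 4 ∨ p % 9 = 7) :
    (∃ x y : ℚ, x ^ 3 + y ^ 3 = p) ∧ (∃ x y : ℚ, x ^ 3 + y ^ 3 = (p : ℚ) ^ 2) :=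
  ⟨exists_cube_add_cube_of_yin hY hp h9 (Or.inl rfl),
    exists_cube_add_cube_of_yin hY hp h9 (Or.inr rfl)⟩

/-- **`rank E_d(ℚ) ≥ 1` for `d ∈ {p, p²}`, `p ≡ 4, 7 (mod 9)` prime — modulo `hY`** (Yin v3, proof
of Thm. 8.7: "`E_{p^i}(ℚ)` … non-torsion"; with Mordell–Weil). Dasgupta–Voight 2018 Thm. 2 proves
`rank = 1` unconditionally under the extra hypothesis "`3` is not a cube modulo `p`".
[cite: Yin2026SylvesterFourSeven, Thm. 8.7 of v3 and its proof] [cite: DasguptaVoight2018, Thm. 2] -/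
theorem one_le_mordellWeilRank_cubeSumCurve_of_yin (hY : exists_not_isOfFinAddOrder_cubeSumCurve)
    {p : ℕ} (hp : p.Prime) (h9 : p % 9 = 4 ∨ p % 9 = 7) {d : ℚ} (hdp : d = p ∨ d = (p : ℚ) ^ 2) :
    1 ≤ (mordellCurve (-(432 * d ^ 2))).mordellWeilRank := by
  obtain ⟨P, hP⟩ := hY hp h9 hdp
  exact one_le_mordellWeilRank_of_not_isOfFinAddOrder_cubeSumCurve
    (ne_zero_of_eq_prime_or_eq_sq hp hdp) hP

/-! ### §2 Door `hY` + Satgé: `rank E_p(ℚ) = 1 = corank Sel_{3^∞}`, `Ш[3^∞]` of corank `0` — parity-free -/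

/-- **`rank E_p(ℚ) = 1`, `corank_{ℤ₃} Sel_{3^∞}(E_p/ℚ) = 1` and `corank_{ℤ₃} Ш(E_p/ℚ)[3^∞] = 0`
for every prime `p ≡ 4, 7 (mod 9)` — modulo `hY`**, with Satgé's published bound `corank ≤ 1`
(`hSel`, Satgé 1986 Thm. 2.9 (2)) and the tree's PROVED identity
`corank Sel_{3^∞} = rank + corank Ш[3^∞]` (`selmerCorank_eq_mordellWeilRank_add_holds`):
`1 ≤ rank ≤ rank + corank Ш = corank Sel ≤ 1`. No root number, no parity theorem, no
`L`-function. [cite: Yin2026SylvesterFourSeven, Thm. 8.7 of v3] [cite: Satge1986, Thm. 2.9 (2)] -/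
theorem mordellWeilRank_eq_one_cubeSumCurve_prime_of_yin
    (hY : exists_not_isOfFinAddOrder_cubeSumCurve)
    (hSel : satge_selmerCorank_three_le_one_of_prime_mod_nine)
    {p : ℕ} (hp : p.Prime) (h9 : p % 9 = 4 ∨ p % 9 = 7) :
    (mordellCurve (-(432 * (p : ℚ) ^ 2))).mordellWeilRank = 1 ∧
      (mordellCurve (-(432 * (p : ℚ) ^ 2))).selmerCorank 3 = 1 ∧
      (mordellCurve (-(432 * (p : ℚ) ^ 2))).shaCorank 3 = 0 := by
  haveI := isElliptic_cubeSumCurve (d := (p : ℚ)) (by exact_mod_cast hp.ne_zero)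
  have h1 := one_le_mordellWeilRank_cubeSumCurve_of_yin hY hp h9 (d := (p : ℚ)) (Or.inl rfl)
  have hle := hSel hp (mod_nine_of_four_seven h9)
  have hid := (mordellCurve (-(432 * (p : ℚ) ^ 2))).selmerCorank_eq_mordellWeilRank_add_holds 3
  omega

/-- Twin of `mordellWeilRank_eq_one_cubeSumCurve_prime_of_yin` with Satgé's bound in the weaker
form printed by Fan–Wan v2 (l. 523), `corank ≤ 2` (inline `hSel2`), which needs the root number
`w(E_p) = −1` (`hw`) and `3`-parity (`hpar`) to exclude corank `2`
(`selmerCorank_three_cubeSumCurve_prime_eq_one_of_le_two`); `hY` then pins the rank.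
[cite: Yin2026SylvesterFourSeven, Thm. 8.7 of v3] [cite: FanWan2023, proof of Thm. 1.2 (v2, l. 523)] -/
theorem mordellWeilRank_eq_one_cubeSumCurve_prime_of_yin_of_le_two
    (hY : exists_not_isOfFinAddOrder_cubeSumCurve)
    (hSel2 : ∀ ⦃p : ℕ⦄, p.Prime → (p % 9 = 4 ∨ p % 9 = 7 ∨ p % 9 = 8) →
      (mordellCurve (-(432 * (p : ℚ) ^ 2))).selmerCorank 3 ≤ 2)
    (hw : rootNumber_cubeSumCurve_prime_eq_neg_one_of_mod_nine)
    (hpar : ∀ (W : WeierstrassCurve ℚ) [W.IsElliptic] (p : ℕ) [Fact p.Prime], p_parity W p)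
    {p : ℕ} (hp : p.Prime) (h9 : p % 9 = 4 ∨ p % 9 = 7) :
    (mordellCurve (-(432 * (p : ℚ) ^ 2))).mordellWeilRank = 1 ∧
      (mordellCurve (-(432 * (p : ℚ) ^ 2))).selmerCorank 3 = 1 ∧
      (mordellCurve (-(432 * (p : ℚ) ^ 2))).shaCorank 3 = 0 := by
  haveI := isElliptic_cubeSumCurve (d := (p : ℚ)) (by exact_mod_cast hp.ne_zero)
  have h1 := one_le_mordellWeilRank_cubeSumCurve_of_yin hY hp h9 (d := (p : ℚ)) (Or.inl rfl)
  have hS := selmerCorank_three_cubeSumCurve_prime_eq_one_of_le_two hSel2 hw hpar hp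
    (mod_nine_of_four_seven h9)
  have hid := (mordellCurve (-(432 * (p : ℚ) ^ 2))).selmerCorank_eq_mordellWeilRank_add_holds 3
  omega

/-! ### §3 Door `hYGZ` + the root number: `ord_{s=1} L(E_p, s) = 1`, rank-BSD and Sylvester for `p` -/

/-- **`ord_{s=1} L(E_p, s) = 1` for every prime `p ≡ 4, 7 (mod 9)` — modulo `hYGZ`** (Yin,
arXiv:2607.01744v1 Thm. 1.1 with v3 Thm. 8.6: `L'(E_p, 1) ≠ 0`): `ord ≤ 1` from `L' ≠ 0`
(`analyticRank_le_of_iteratedDeriv_ne_zero`), `ord` odd from `w(E_p) = −1` (`hw`,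
Dasgupta–Voight 2018 (2); `odd_analyticRank_of_rootNumber_eq_neg_one`), and `L(E_p, s)` entire
from `w = −1` unconditionally (`hasEntireLFunction_of_rootNumber_eq_neg_one`). Compare
`analyticRank_eq_one_cubeSumCurve_prime_of_converse` (first door, via Selmer corank and `hK3`).
[cite: Yin2026SylvesterGrossZagier, Thm. 1.1 of v1] [cite: DasguptaVoight2018, §1.1 display (2)] -/
theorem analyticRank_eq_one_cubeSumCurve_prime_of_yinGZ
    (hYGZ : deriv_entireLFunction_one_ne_zero_cubeSumCurve)
    (hw : rootNumber_cubeSumCurve_prime_eq_neg_one_of_mod_nine)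
    {p : ℕ} (hp : p.Prime) (h9 : p % 9 = 4 ∨ p % 9 = 7) :
    (mordellCurve (-(432 * (p : ℚ) ^ 2))).analyticRank = 1 := by
  haveI := isElliptic_cubeSumCurve (d := (p : ℚ)) (by exact_mod_cast hp.ne_zero)
  have hw' := hw hp (mod_nine_of_four_seven h9)
  have hL := WeierstrassCurve.hasEntireLFunction_of_rootNumber_eq_neg_one hw'
  have hle : (mordellCurve (-(432 * (p : ℚ) ^ 2))).analyticRank ≤ 1 :=
    analyticRank_le_of_iteratedDeriv_ne_zero _ hL (n := 1)
      (by rw [iteratedDeriv_one]; exact hYGZ hp h9 (Or.inl rfl))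
  have hpos := WeierstrassCurve.analyticRank_pos_of_rootNumber_eq_neg_one hw'
  omega

/-- **Rank-BSD for `E_p`, `p ≡ 4, 7 (mod 9)` prime — modulo `hYGZ`**: `ord_{s=1} L(E_p, s) = 1`
(`analyticRank_eq_one_cubeSumCurve_prime_of_yinGZ`), hence by Gross–Zagier–Kolyvagin (`hGZK`)
`rank E_p(ℚ) = 1` and `#Ш(E_p/ℚ) < ∞`. Yin v3's Thm. 8.7 is NOT used.
[cite: Yin2026SylvesterGrossZagier, Thm. 1.1 of v1] [cite: Darmon2004, Thm. 3.22] -/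
theorem bsdRank_cubeSumCurve_prime_of_yinGZ
    (hYGZ : deriv_entireLFunction_one_ne_zero_cubeSumCurve)
    (hGZK : rank_eq_analyticRank_of_analyticRank_le_one)
    (hw : rootNumber_cubeSumCurve_prime_eq_neg_one_of_mod_nine)
    {p : ℕ} (hp : p.Prime) (h9 : p % 9 = 4 ∨ p % 9 = 7) :
    (mordellCurve (-(432 * (p : ℚ) ^ 2))).analyticRank = 1 ∧
      (mordellCurve (-(432 * (p : ℚ) ^ 2))).mordellWeilRank = 1 ∧
      Finite (mordellCurve (-(432 * (p : ℚ) ^ 2))).sha := by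
  haveI := isElliptic_cubeSumCurve (d := (p : ℚ)) (by exact_mod_cast hp.ne_zero)
  have hran := analyticRank_eq_one_cubeSumCurve_prime_of_yinGZ hYGZ hw hp h9
  obtain ⟨heq, hsha⟩ := hGZK (mordellCurve (-(432 * (p : ℚ) ^ 2))) hran.le
  exact ⟨hran, by rw [heq, hran], hsha⟩

/-- **Sylvester for `p ≡ 4, 7 (mod 9)` through the Gross–Zagier door** — modulo `hYGZ`, with
Gross–Zagier–Kolyvagin (`hGZK`) and the root number (`hw`): `rank E_p(ℚ) = 1 ≠ 0`, so `E_p` has an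
affine rational point (`exists_nonsingular_ne_zero_of_mordellWeilRank_ne_zero`) and `x³ + y³ = p`
is soluble. Independent of v3's Thm. 8.7 (but `hYGZ` leans on v3's Thm. 8.6).
[cite: Yin2026SylvesterGrossZagier, Thm. 1.1 of v1] [cite: DasguptaVoight2018, Conj. 1] -/
theorem exists_cube_add_cube_eq_prime_of_yinGZ
    (hYGZ : deriv_entireLFunction_one_ne_zero_cubeSumCurve)
    (hGZK : rank_eq_analyticRank_of_analyticRank_le_one)
    (hw : rootNumber_cubeSumCurve_prime_eq_neg_one_of_mod_nine)
    {p : ℕ} (hp : p.Prime) (h9 : p % 9 = 4 ∨ p % 9 = 7) :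
    ∃ x y : ℚ, x ^ 3 + y ^ 3 = p := by
  obtain ⟨-, hMW, -⟩ := bsdRank_cubeSumCurve_prime_of_yinGZ hYGZ hGZK hw hp h9
  obtain ⟨X, Y, hXY, -⟩ := exists_nonsingular_ne_zero_of_mordellWeilRank_ne_zero
    (mordellCurve (-(432 * (p : ℚ) ^ 2))) rfl rfl (by rw [hMW]; exact one_ne_zero)
  exact exists_cube_add_cube_of_mordellCurve_equation (by exact_mod_cast hp.ne_zero) hXY.1

/-! ### §4 Both doors: rank-BSD for `E_p` AND `E_{p²}` -/

/-- **`ord_{s=1} L(E_d, s) = rank E_d(ℚ) = 1` and `#Ш(E_d/ℚ) < ∞` for `d ∈ {p, p²}`, `p ≡ 4, 7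
(mod 9)` prime — the rank part of BSD for these curves, modulo Yin's two claims** (`hY`: a point
of infinite order, v3 Thm. 8.7; `hYGZ`: `L'(E_d, 1) ≠ 0`, sequel Thm. 1.1), with
Gross–Zagier–Kolyvagin (`hGZK`) and the Deuring–Hecke continuation of `L(E_d, s)` (`hH`, `j = 0`).
This is the companion's "rank `=` analytic rank `= 1`" clause for the classes `4, 7`, for `p²` as
well as `p` (for `p` alone `bsdRank_cubeSumCurve_prime_of_yinGZ` needs neither `hY` nor `hH`).
[cite: Yin2026SylvesterGrossZagier, Thm. 1.1 of v1] [cite: Yin2026SylvesterFourSeven, Thm. 8.7 of v3]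
[cite: Darmon2004, Thm. 3.22] -/
theorem bsdRank_cubeSumCurve_of_yin
    (hY : exists_not_isOfFinAddOrder_cubeSumCurve)
    (hYGZ : deriv_entireLFunction_one_ne_zero_cubeSumCurve)
    (hGZK : rank_eq_analyticRank_of_analyticRank_le_one)
    (hH : hasEntireLFunction_of_j_mem_maximalCMJInvariants)
    {p : ℕ} (hp : p.Prime) (h9 : p % 9 = 4 ∨ p % 9 = 7) {d : ℚ} (hdp : d = p ∨ d = (p : ℚ) ^ 2) :
    (mordellCurve (-(432 * d ^ 2))).analyticRank = 1 ∧
      (mordellCurve (-(432 * d ^ 2))).mordellWeilRank = 1 ∧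
      Finite (mordellCurve (-(432 * d ^ 2))).sha := by
  have hd := ne_zero_of_eq_prime_or_eq_sq hp hdp
  haveI := isElliptic_cubeSumCurve hd
  exact bsdRank_of_deriv_ne_zero_of_one_le_mordellWeilRank hGZK _
    (hasEntireLFunction_cubeSumCurve hH hd) (hYGZ hp h9 hdp)
    (one_le_mordellWeilRank_cubeSumCurve_of_yin hY hp h9 hdp)

/-- The `p²` clause of `bsdRank_cubeSumCurve_of_yin` spelled out: for every prime
`p ≡ 4, 7 (mod 9)`, `ord_{s=1} L(E_{p²}, s) = rank E_{p²}(ℚ) = 1` and `#Ш(E_{p²}/ℚ) < ∞`, modulo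
`hY`, `hYGZ`, with `hGZK` and `hH`. [cite: Yin2026SylvesterGrossZagier, Thm. 1.1 of v1 (i = 2)]
[cite: Yin2026SylvesterFourSeven, Thm. 8.7 of v3 (p²)] -/
theorem bsdRank_cubeSumCurve_prime_sq_of_yin
    (hY : exists_not_isOfFinAddOrder_cubeSumCurve)
    (hYGZ : deriv_entireLFunction_one_ne_zero_cubeSumCurve)
    (hGZK : rank_eq_analyticRank_of_analyticRank_le_one)
    (hH : hasEntireLFunction_of_j_mem_maximalCMJInvariants)
    {p : ℕ} (hp : p.Prime) (h9 : p % 9 = 4 ∨ p % 9 = 7) :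
    (mordellCurve (-(432 * ((p : ℚ) ^ 2) ^ 2))).analyticRank = 1 ∧
      (mordellCurve (-(432 * ((p : ℚ) ^ 2) ^ 2))).mordellWeilRank = 1 ∧
      Finite (mordellCurve (-(432 * ((p : ℚ) ^ 2) ^ 2))).sha :=
  bsdRank_cubeSumCurve_of_yin hY hYGZ hGZK hH hp h9 (Or.inr rfl)

end Literature.NumberTheory.EllipticCurves.Yin2026

end
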